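import Mathlib
import HarnessLib
import Summits.HubbardSuperconductivity.HubbardSuperconductivity.Theorems.KLProgrammeKLRegimeSplitTwoLegSizesZeroFromPosition
import Summits.HubbardSuperconductivity.HubbardSuperconductivity.Theorems.KLProgrammeKLRegimeSplitTwoLegIncrementSizes

/-!
# Route `KLProgramme` — gen-5 ENGINE child, stub `stub_twoLeg_scale0`: ORDER-RESOLVED (E3a) tier-1 sizes of the scale-`0` piece
# `ℓ_0(K.eval) = E_μ(ν_0 − K∘k_F^K)` from the scale-`0` position kernel moments and the frame's β-FREE `C²` size

Cell `gate-hubbard-kl`, seat p1b (g6).  The coarse `…TwoLegSizesZeroFromPosition` (p487292) lumps all orders into one constant carrying the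
β-dependent `C⁴` sizes of the frame; as k3c3-p3 g3 pointed out for `ℓ_{n+1}` (p488152), the β-free fit into `twoLegBar G Q U j 0` needs the
ORDER-RESOLVED form: orders `j ≤ 2` read only the moments `Mˢ_0 … Mˢ_2`, the frame's `C²` size `A = 2Gfr₀|U| + 2Gfr₁U² + Gfr₂·c/log 4`
(β-free) and the absolute curve constants `klCurveD1`, `klCurveD2` (k3c3-p3's tower).  With `T^K := S_0^K − K` (frame vertex cancelled),
`M_k := 2Mˢ_k + A` (`k ≤ 2`):
**`twoLegPieceFn_eval_zero_tier1_size_le`**: `‖Dʲ onM ℓ_0(K.eval)(q)‖ ≤ [j=0]·M₀ + (j!)²(2·j!·X·200ʲ)·G_j·(4 + max 1 ((j−1)!/(8/5)))ʲ`,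
`G₀ = 2M₀`, `G₁ = (2π+1)·M₁·klCurveD1`, `G₂ = G₁ + M₂·klCurveD1² + M₁·klCurveD2`, `j ≤ 2`, in k3c3-p3's explicit regime
(`c ≤ klCurveC3 R`, `U ≤ klCurveU0 R`).  Proof only; nothing about the model is asserted.  References: BGM 2006 (2.36), §2.4 Lemma 2.1
[cite: BenfattoGiulianiMastropietro2006].
-/

noncomputable section

namespace Summit.HubbardSuperconductivity.HubbardSuperconductivity.Theorems.KLRegimeSplit

set_option linter.dupNamespace false -- summit = problem name (single-conjunct summit), D-0017

open Real Finset
open Literature.MathematicalPhysics.QuantumLattice Literature.MathematicalPhysics.QuantumLattice.BandSectorCounting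
open Literature.Probability.LatticeModels
open Summit.HubbardSuperconductivity.HubbardSuperconductivity.Theorems.DispersionFlow
open Summit.HubbardSuperconductivity.HubbardSuperconductivity.Theorems.PerturbedFermiCurve
open Summit.HubbardSuperconductivity.HubbardSuperconductivity.Theorems.KLProgrammeLegKernels
open Summit.HubbardSuperconductivity.HubbardSuperconductivity.Theorems.TwoLegFourier

variable {L M : ℕ} [NeZero L] [NeZero M]

/-- **(E3a) tier 1 of the scale-`0` piece, ORDER-RESOLVED** (see the module docstring). -/
theorem twoLegPieceFn_eval_zero_tier1_size_le {R : RenConsts} (hR : ∀ j, 0 ≤ R.Gfr j) {c : ℝ} (hc : 0 < c) (hcle : c ≤ klCurveC3 R)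
    {U : ℝ} (hU : 0 < U) (hUle : U ≤ klCurveU0 R) {β : ℝ} (hβmin : klBetaMin ≤ β) (hβc : β ≤ Real.exp (c / U ^ 2))
    {μ : ℝ} (hμ : μ ∈ klWindowC) {K : TrigPolyC4v} (hK : FrameOK R U (nScales β) μ K) {Ms : ℕ → ℝ}
    (hMs : ∀ k ≤ 4, ∀ (σ : Fin 2) (x₀ : SpaceTimeIdx L M), imagTimeWeight β M *
      ∑ x ∈ (univ : Finset (Fin 2 → SpaceTimeIdx L M)).filter (fun x => x 0 = x₀),
        (1 + ((((x 1).2 - (x 0).2) 0).valMinAbs.natAbs : ℝ) + ((((x 1).2 - (x 0).2) 1).valMinAbs.natAbs : ℝ)) ^ k *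
          ‖sectorisedKernel L M β (trivialMultiplier L M) (klEffectiveAction L M β U μ K klE0 0) 2
            (![((0, σ), 0), ((0, σ), 1)] : Fin 2 → SectorLeg 1) x‖ ≤ Ms k)
    {j : ℕ} (hj : j ≤ 2) {X : ℝ} (hX : ∀ l ≤ j, ∀ x : ℝ, ‖iteratedFDeriv ℝ l salmhoferCutoff x‖ ≤ X) (q : Momentum) :
    ‖iteratedFDeriv ℝ j (onM (klTwoLegPieceFn L M β U μ K.eval 0)) q‖ ≤
      (if j = 0 then 2 * Ms 0 + (2 * R.Gfr 0 * |U| + 2 * R.Gfr 1 * U ^ 2 + R.Gfr 2 * (c / Real.log 4)) else 0) +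
        (j.factorial : ℝ) ^ 2 * (2 * j.factorial * X * 200 ^ j) *
          (if j = 0 then 2 * (2 * Ms 0 + (2 * R.Gfr 0 * |U| + 2 * R.Gfr 1 * U ^ 2 + R.Gfr 2 * (c / Real.log 4))) else
            (2 * π + 1) * ((2 * Ms 1 + (2 * R.Gfr 0 * |U| + 2 * R.Gfr 1 * U ^ 2 + R.Gfr 2 * (c / Real.log 4))) * klCurveD1) +
              (if j = 2 then (2 * Ms 2 + (2 * R.Gfr 0 * |U| + 2 * R.Gfr 1 * U ^ 2 + R.Gfr 2 * (c / Real.log 4))) * klCurveD1 ^ 2 +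
                (2 * Ms 1 + (2 * R.Gfr 0 * |U| + 2 * R.Gfr 1 * U ^ 2 + R.Gfr 2 * (c / Real.log 4))) * klCurveD2 else 0)) *
          (4 + max 1 (((j - 1).factorial : ℝ) / (8 / 5))) ^ j := by
  have ha : (-4 : ℝ) < -1.1 := by norm_num
  have hab : (-1.1 : ℝ) ≤ -0.1 := by norm_num
  have hb : (-0.1 : ℝ) < 0 := by norm_num
  set B := bandBounds ha hab hb with hBdef
  obtain ⟨hAf, hA20, hADt, -, ⟨hlo, hhi⟩, hA3f, hA4f⟩ := frame_sizes_of_frameOK_explicit hR hc hcle hU hUle hβmin hβc hμ hK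
  set A := 2 * R.Gfr 0 * |U| + 2 * R.Gfr 1 * U ^ 2 + R.Gfr 2 * (c / Real.log 4) with hAdef
  have hβ : 0 < β := lt_of_lt_of_le (by unfold klBetaMin; norm_num) hβmin
  -- the reading function `T = S₀ − K` and the profile `δ₀ = T ∘ γ`
  set S₀ := symInterp L (klLocSelfEnergyRe L M β U μ K 0) with hS₀
  set F : Momentum → ℝ := fun p => evalM S₀ p - evalM K p with hF
  set γ : ℝ → Momentum := fun θ => (WithLp.toLp 2 (klFermiPoint μ K θ) : Momentum) with hγdef
  set δ : ℝ → ℝ := fun θ => klLocalPart L M β U μ K 0 θ - K.eval (klFermiPoint μ K θ) with hδ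
  have hδF : δ = F ∘ γ := klLocalPart_zero_sub_frame_eq_comp β U μ K
  have hFc : ContDiff ℝ 4 F := (contDiff_evalM S₀).sub (contDiff_evalM K)
  -- momentum-side sizes `M k` of `F` (orders ≤ 2 from `A`; 3, 4 from the β-dependent sizes, used only to invoke the tower)
  set Mf : ℕ → ℝ := fun k => 2 * Ms k + (if k ≤ 2 then A else if k = 3 then R.Gfr 3 * U ^ 2 * ((4 : ℝ) ^ (nScales β + 1) / 3)
    else R.Gfr 4 * U ^ 2 * ((16 : ℝ) ^ (nScales β + 1) / 15)) with hMf
  have hS : ∀ k ≤ 4, ∀ p : Momentum, ‖iteratedFDeriv ℝ k (evalM S₀) p‖ ≤ 2 * Ms k := fun k hk p =>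
    norm_iteratedFDeriv_evalM_symInterp_le_of_moments (sum_weight_abs_torusCosCoeff_klLocSelfEnergyRe_le hβ U μ K 0 k (hMs k hk)) p
  have hKk : ∀ k ≤ 4, ∀ p : Momentum, ‖iteratedFDeriv ℝ k (evalM K) p‖ ≤ (if k ≤ 2 then A else
      if k = 3 then R.Gfr 3 * U ^ 2 * ((4 : ℝ) ^ (nScales β + 1) / 3) else R.Gfr 4 * U ^ 2 * ((16 : ℝ) ^ (nScales β + 1) / 15)) := by
    intro k hk p
    rw [norm_iteratedFDeriv_evalM_eq_frameShift]
    by_cases hk2 : k ≤ 2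
    · rw [if_pos hk2]; exact hAf p k hk2
    · rw [if_neg hk2]
      rcases (show k = 3 ∨ k = 4 by omega) with rfl | rfl
      · simpa using hA3f p
      · simpa using hA4f p
  have hMk : ∀ k ≤ 4, ∀ p : Momentum, ‖iteratedFDeriv ℝ k F p‖ ≤ Mf k := fun k hk p => by
    rw [hF, fun_iteratedFDeriv_sub_apply ((contDiff_evalM S₀).contDiffAt.of_le le_top) ((contDiff_evalM K).contDiffAt.of_le le_top)]
    exact (norm_sub_le _ _).trans (add_le_add (hS k hk p) (hKk k hk p))
  have hM0 : Mf 0 = 2 * Ms 0 + A := by simp [hMf]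
  have hM1 : Mf 1 = 2 * Ms 1 + A := by simp [hMf]
  have hM2 : Mf 2 = 2 * Ms 2 + A := by simp [hMf]
  -- the profile: value, first and second derivative
  have hval : ∀ θ, |δ θ| ≤ 2 * Ms 0 + A := fun θ => by
    rw [hδF, Function.comp_apply, ← Real.norm_eq_abs, ← norm_iteratedFDeriv_zero (𝕜 := ℝ), ← hM0]
    exact hMk 0 (by norm_num) _
  have hstruct := fun θ => abs_iteratedDeriv_comp_fermiPointLp_le_struct hR hc hcle hU hUle hβmin hβc hμ hK hA3f hA4f hFc θ
    (m := Mf) (fun k _ hk4 => hMk k hk4 _)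
  have hδc : ContDiff ℝ 4 δ := by
    rw [hδF]; exact hFc.comp (fermiPointLp_sizes_explicit hR hc hcle hU hUle hβmin hβc hμ hK hA3f hA4f 0).1
  have hdiff : Differentiable ℝ δ := hδc.differentiable (by norm_num)
  have hper : Function.Periodic δ (2 * π) := fun θ => by
    simp only [hδ, klLocalPart_periodic β U μ K 0 θ, frameOnCurve_periodic μ K θ]
  have h1 : ∀ θ, |deriv δ θ| ≤ (2 * Ms 1 + A) * klCurveD1 := fun θ => by
    rw [← iteratedDeriv_one, hδF, ← hM1]; exact (hstruct θ).1
  have h2 : ∀ θ, |iteratedDeriv 2 δ θ| ≤ (2 * Ms 2 + A) * klCurveD1 ^ 2 + (2 * Ms 1 + A) * klCurveD2 := fun θ => by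
    rw [hδF, ← hM1, ← hM2]; exact (hstruct θ).2.1
  have hmean : |klAngularMean δ| ≤ 2 * Ms 0 + A := abs_klAngularMean_le' hval
  have hosc : ∀ t, |δ t - klAngularMean δ| ≤ 2 * π * ((2 * Ms 1 + A) * klCurveD1) := fun t =>
    abs_sub_klAngularMean_le_of_deriv hdiff hper h1 t
  have hB1 : 0 ≤ (2 * Ms 1 + A) * klCurveD1 := (abs_nonneg _).trans (h1 0)
  have hB2 : 0 ≤ (2 * Ms 2 + A) * klCurveD1 ^ 2 + (2 * Ms 1 + A) * klCurveD2 := (abs_nonneg _).trans (h2 0)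
  -- the centred profile's `iteratedFDeriv` sizes, per order
  have hcd : ∀ i ≤ 2, ∀ t, 1 ≤ i → iteratedFDeriv ℝ i (fun t => δ t - klAngularMean δ) t = iteratedFDeriv ℝ i δ t := by
    intro i hi t hi1
    rw [fun_iteratedFDeriv_sub_apply (hδc.contDiffAt.of_le (by exact_mod_cast hi.trans (by norm_num))) contDiffAt_const,
      iteratedFDeriv_const_of_ne (by omega), Pi.zero_apply, sub_zero]
  have hG0 : ∀ t, ‖iteratedFDeriv ℝ 0 (fun t => δ t - klAngularMean δ) t‖ ≤ 2 * (2 * Ms 0 + A) := fun t => by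
    rw [norm_iteratedFDeriv_zero, Real.norm_eq_abs]
    have := abs_sub (δ t) (klAngularMean δ); have := hval t; linarith
  have hG0' : ∀ t, ‖iteratedFDeriv ℝ 0 (fun t => δ t - klAngularMean δ) t‖ ≤ (2 * π + 1) * ((2 * Ms 1 + A) * klCurveD1) := fun t => by
    rw [norm_iteratedFDeriv_zero, Real.norm_eq_abs]; have := hosc t; nlinarith
  have hG1 : ∀ t, ‖iteratedFDeriv ℝ 1 (fun t => δ t - klAngularMean δ) t‖ ≤ (2 * π + 1) * ((2 * Ms 1 + A) * klCurveD1) := fun t => by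
    rw [hcd 1 (by norm_num) t le_rfl, norm_iteratedFDeriv_eq_norm_iteratedDeriv, iteratedDeriv_one, Real.norm_eq_abs]
    have := h1 t; nlinarith [Real.pi_pos]
  have hG2 : ∀ t, ‖iteratedFDeriv ℝ 2 (fun t => δ t - klAngularMean δ) t‖ ≤
      (2 * Ms 2 + A) * klCurveD1 ^ 2 + (2 * Ms 1 + A) * klCurveD2 := fun t => by
    rw [hcd 2 le_rfl t (by norm_num), norm_iteratedFDeriv_eq_norm_iteratedDeriv, Real.norm_eq_abs]; exact h2 t
  -- the piece as a G-extension and k3c3-p1's calculus, per order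
  have h0c : Continuous (klLocalPart L M β U μ K 0) := (contDiff_klLocalPart B hAf hADt hlo hhi L M β U 0 (m := 0)).continuous
  have hKc : Continuous fun θ => K.eval (klFermiPoint μ K θ) := (contDiff_eval_klFermiPoint B hAf hADt hlo hhi K (m := 0)).continuous
  have hP := klTwoLegPieceFn_eval_zero (L := L) (M := M) β U μ K h0c hKc
  have key : ∀ {G : ℝ}, (∀ i ≤ j, ∀ t : ℝ, ‖iteratedFDeriv ℝ i (fun t => δ t - klAngularMean δ) t‖ ≤ G) →
      ‖iteratedFDeriv ℝ j (onM (klTwoLegPieceFn L M β U μ K.eval 0)) q‖ ≤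
        (if j = 0 then 2 * Ms 0 + A else 0) +
          (j.factorial : ℝ) ^ 2 * (2 * j.factorial * X * 200 ^ j) * G * (4 + max 1 (((j - 1).factorial : ℝ) / (8 / 5))) ^ j := by
    intro G hG
    have hmain := norm_iteratedFDeriv_onM_piece_le hP (N := 4) hδc hper (j := j) (by exact_mod_cast hj.trans (by norm_num)) hμ hG hX q
    refine hmain.trans (add_le_add ?_ le_rfl)
    split_ifs
    · exact hmean
    · exact le_rfl
  rcases Nat.lt_or_ge j 1 with hj0 | hj1
  · have hj0' : j = 0 := by omega
    subst hj0'
    simp only [if_true] at key ⊢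
    exact key fun i hi t => by
      have hi0 : i = 0 := by omega
      subst hi0; exact hG0 t
  · have hjne : j ≠ 0 := by omega
    rcases Nat.lt_or_ge j 2 with hj1' | hj2
    · have hj1'' : j = 1 := by omega
      subst hj1''
      simp only [if_neg one_ne_zero, show (1 : ℕ) ≠ 2 by norm_num, if_false, add_zero] at key ⊢
      exact key fun i hi t => by
        rcases Nat.eq_zero_or_pos i with rfl | hipos
        · exact hG0' t
        · have hi1 : i = 1 := by omega
          subst hi1; exact hG1 t
    · have hj2' : j = 2 := by omega
      subst hj2'
      simp only [show (2 : ℕ) ≠ 0 by norm_num, if_false, if_true] at key ⊢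
      exact key fun i hi t => by
        rcases Nat.eq_zero_or_pos i with rfl | hipos
        · exact (hG0' t).trans (le_add_of_nonneg_right hB2)
        · rcases (show i = 1 ∨ i = 2 by omega) with rfl | rfl
          · exact (hG1 t).trans (le_add_of_nonneg_right hB2)
          · exact (hG2 t).trans (le_add_of_nonneg_left (by positivity))

end Summit.HubbardSuperconductivity.HubbardSuperconductivity.Theorems.KLRegimeSplit

end
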